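import Mathlib
import Summits.NavierStokesRegularity.NavierStokesRegularity.Theorems.FilamentSkeletonRssTangentSkeletonNearStraightNewtonKantorovich

/-!
# Newton–Kantorovich with a right inverse — PARAMETRISED version: the zero depends continuously on a parameter
# (`FilamentSkeletonRss`, child crux `TangentSkeletonNearStraight`, stmt-NavierStokesRegularity-28295, line
# `child_tangent_analytic_strip`, ∃-side of the registered stub `stub_analyticClosing`, step (iv); same pattern as the
# `ContinuousOn B` clause of `AlmostAdmissibleJ` in the sibling line `kelvin_gate` of `TransverseReductionRJ`)

`Theorems.NewtonKantorovich.iterate_tendsto` produces the zero of `f` as the limit of the EXPLICIT simplified-Newton iterates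
`x_{n+1} = xₙ − L f(xₙ)` with the geometric rate `‖xₙ − x⋆‖ ≤ ‖L‖‖f x₀‖ qⁿ/(1 − q)`.  When the problem depends on a parameter
`p ∈ S` — `f p`, its frozen right inverse `L p`, the initial guess `x₀ p` — with the contraction data `δ, q, r` and a residual
bound `a ≥ ‖L p‖‖f p (x₀ p)‖` UNIFORM on `S`, and the one-step map `(p, x) ↦ x − L p (f p x)` jointly continuous, the iterates are
continuous in `p` (induction) and converge uniformly on `S`, so the zero map `p ↦ x⋆(p)` is continuous on `S`
(`TendstoUniformlyOn.continuousOn`).  This records exactly WHICH uniformity a parametrised closing needs: uniform contraction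
data and a jointly continuous step — not merely pointwise-in-`p` continuity of the linear solver for fixed data.

* `iterate_continuousOn` — each iterate `p ↦ xₙ(p)` is continuous on `S`;
* `zero_continuousOn` — the limit zero map is continuous on `S`, lies in the balls, kills `f p`, and obeys the a-priori bound.

HONEST FRAMING: textbook functional analysis (uniform contraction principle, [Deimling, Nonlinear Functional Analysis, §15];
folklore) serving a plan about a HYPOTHETICAL filament skeleton on the NEGATIVE side of a MODEL route; no registered stub is
closed by this file and nothing here bears on Navier–Stokes regularity or blow-up.  `--supports stmt-NavierStokesRegularity-28295`.
-/

set_option linter.dupNamespace false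

noncomputable section

namespace Summit.NavierStokesRegularity.NavierStokesRegularity.Theorems.NewtonKantorovich

open Set Metric Filter Topology

variable {E F : Type*} [NormedAddCommGroup E] [NormedSpace ℝ E] [NormedAddCommGroup F] [NormedSpace ℝ F]
variable {P : Type*} [TopologicalSpace P]

/-- The explicit simplified-Newton iterates satisfy the recursion (bookkeeping for `Function.iterate`). [folklore] -/
theorem iterate_succ_eq {α : Type*} (T : α → α) (x : α) (n : ℕ) : T^[n + 1] x = T (T^[n] x) :=
  Function.iterate_succ_apply' T n x

/-- **The parametrised iterates are continuous in the parameter.**  If the initial guess `x₀` is continuous on `S`, the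
one-step map `(p, x) ↦ x − L p (f p x)` is continuous on `{(p, x) | p ∈ S, x ∈ closedBall (x₀ p) r}`, and (uniform
contraction data) every iterate stays in its ball, then `p ↦ xₙ(p)` is continuous on `S` for every `n`. [folklore] -/
theorem iterate_continuousOn {S : Set P} {f : P → E → F} {f' : P → E → E →L[ℝ] F} {x₀ : P → E} {L : P → F →L[ℝ] E}
    {r δ q : ℝ}
    (hf : ∀ p ∈ S, ∀ z ∈ closedBall (x₀ p) r, HasFDerivWithinAt (f p) (f' p z) (closedBall (x₀ p) r) z)
    (hL : ∀ p ∈ S, ∀ y, f' p (x₀ p) (L p y) = y)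
    (hδ : ∀ p ∈ S, ∀ z ∈ closedBall (x₀ p) r, ‖f' p z - f' p (x₀ p)‖ ≤ δ)
    (hq : ∀ p ∈ S, δ * ‖L p‖ ≤ q) (hq1 : q < 1) (hr : ∀ p ∈ S, ‖L p‖ * ‖f p (x₀ p)‖ ≤ (1 - q) * r)
    (hx₀ : ContinuousOn x₀ S)
    (hG : ContinuousOn (fun px : P × E => px.2 - L px.1 (f px.1 px.2)) {px | px.1 ∈ S ∧ px.2 ∈ closedBall (x₀ px.1) r})
    (n : ℕ) :
    ContinuousOn (fun p => (fun x => x - L p (f p x))^[n] (x₀ p)) S := by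
  induction n with
  | zero => simpa using hx₀
  | succ m ih =>
    have hmem : ∀ p ∈ S, (fun x => x - L p (f p x))^[m] (x₀ p) ∈ closedBall (x₀ p) r := by
      intro p hp
      exact (iterate_bounds (L p) (hf p hp) (hL p hp) (hδ p hp) (hq p hp) hq1 (hr p hp)
        (xs := fun k => (fun x => x - L p (f p x))^[k] (x₀ p)) rfl
        (fun k => iterate_succ_eq _ _ k) m).1
    have hpair : ContinuousOn (fun p => (p, (fun x => x - L p (f p x))^[m] (x₀ p))) S :=
      continuousOn_id.prodMk ih
    have hmaps : MapsTo (fun p => (p, (fun x => x - L p (f p x))^[m] (x₀ p))) S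
        {px : P × E | px.1 ∈ S ∧ px.2 ∈ closedBall (x₀ px.1) r} := fun p hp => ⟨hp, hmem p hp⟩
    have hcomp := hG.comp hpair hmaps
    refine hcomp.congr (fun p hp => ?_)
    simp only [Function.comp_apply]
    exact iterate_succ_eq _ _ m

/-- **Continuous dependence of the Newton–Kantorovich zero on a parameter.**  `E` complete.  On the parameter set `S`:
differentiability of `f p` on `closedBall (x₀ p) r`, a right inverse `L p` of `f′ p (x₀ p)`, the deviation bound `δ`, the
contraction `δ‖L p‖ ≤ q < 1`, the start-up inequality `‖L p‖‖f p (x₀ p)‖ ≤ (1 − q) r` and a residual bound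
`‖L p‖‖f p (x₀ p)‖ ≤ a`, all UNIFORM in `p`; `x₀` continuous on `S`; the one-step map jointly continuous on
`{(p, x) | p ∈ S, x ∈ closedBall (x₀ p) r}`.  Then there is a zero map `x⋆ : P → E`, CONTINUOUS ON `S`, with
`x⋆ p ∈ closedBall (x₀ p) r`, `f p (x⋆ p) = 0` and `‖x⋆ p − x₀ p‖ ≤ ‖L p‖‖f p (x₀ p)‖/(1 − q)` for `p ∈ S`. [folklore] -/
theorem zero_continuousOn [CompleteSpace E] {S : Set P} {f : P → E → F} {f' : P → E → E →L[ℝ] F} {x₀ : P → E}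
    {L : P → F →L[ℝ] E} {r δ q a : ℝ}
    (hf : ∀ p ∈ S, ∀ z ∈ closedBall (x₀ p) r, HasFDerivWithinAt (f p) (f' p z) (closedBall (x₀ p) r) z)
    (hL : ∀ p ∈ S, ∀ y, f' p (x₀ p) (L p y) = y)
    (hδ : ∀ p ∈ S, ∀ z ∈ closedBall (x₀ p) r, ‖f' p z - f' p (x₀ p)‖ ≤ δ)
    (hq : ∀ p ∈ S, δ * ‖L p‖ ≤ q) (hq1 : q < 1) (hr : ∀ p ∈ S, ‖L p‖ * ‖f p (x₀ p)‖ ≤ (1 - q) * r)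
    (ha : ∀ p ∈ S, ‖L p‖ * ‖f p (x₀ p)‖ ≤ a)
    (hx₀ : ContinuousOn x₀ S)
    (hG : ContinuousOn (fun px : P × E => px.2 - L px.1 (f px.1 px.2)) {px | px.1 ∈ S ∧ px.2 ∈ closedBall (x₀ px.1) r}) :
    ∃ xz : P → E, ContinuousOn xz S ∧ ∀ p ∈ S, xz p ∈ closedBall (x₀ p) r ∧ f p (xz p) = 0 ∧
      ‖xz p - x₀ p‖ ≤ ‖L p‖ * ‖f p (x₀ p)‖ / (1 - q) := by
  classical
  -- the iterates and their pointwise limits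
  let xs : P → ℕ → E := fun p n => (fun x => x - L p (f p x))^[n] (x₀ p)
  have h0 : ∀ p, xs p 0 = x₀ p := fun p => rfl
  have hstep : ∀ p n, xs p (n + 1) = xs p n - L p (f p (xs p n)) := fun p n => iterate_succ_eq _ _ n
  have key : ∀ p ∈ S, ∃ xinf ∈ closedBall (x₀ p) r, Tendsto (xs p) atTop (𝓝 xinf) ∧ f p xinf = 0 ∧
      ‖xinf - x₀ p‖ ≤ ‖L p‖ * ‖f p (x₀ p)‖ / (1 - q) ∧
      ∀ n, ‖xs p n - xinf‖ ≤ ‖L p‖ * ‖f p (x₀ p)‖ * q ^ n / (1 - q) := fun p hp =>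
    iterate_tendsto (L p) (hf p hp) (hL p hp) (hδ p hp) (hq p hp) hq1 (hr p hp) (h0 p) (hstep p)
  -- the zero map: the limit on `S`, anything (say `x₀`) elsewhere
  let xz : P → E := fun p => if hp : p ∈ S then (key p hp).choose else x₀ p
  have hxz : ∀ p (hp : p ∈ S), xz p = (key p hp).choose := fun p hp => by simp [xz, hp]
  refine ⟨xz, ?_, fun p hp => ?_⟩
  · -- continuity on `S`: uniform limit of continuous iterates
    by_cases hS : S.Nonempty
    swap
    · rw [not_nonempty_iff_eq_empty.mp hS]; exact continuousOn_empty _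
    obtain ⟨p₀, hp₀⟩ := hS
    have hx₀mem : x₀ p₀ ∈ closedBall (x₀ p₀) r := mem_closedBall_self
      (radius_nonneg (mul_nonneg (norm_nonneg _) (norm_nonneg _)) hq1 (hr p₀ hp₀))
    have hδ0 : 0 ≤ δ := le_trans (norm_nonneg _) (hδ p₀ hp₀ (x₀ p₀) hx₀mem)
    have hq0 : 0 ≤ q := le_trans (mul_nonneg hδ0 (norm_nonneg _)) (hq p₀ hp₀)
    have h1q : 0 < 1 - q := by linarith
    have ha0 : 0 ≤ a := le_trans (mul_nonneg (norm_nonneg _) (norm_nonneg _)) (ha p₀ hp₀)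
    have hunif : TendstoUniformlyOn (fun n p => xs p n) xz atTop S := by
      rw [Metric.tendstoUniformlyOn_iff]
      intro ε hε
      have hgeom : Tendsto (fun n : ℕ => a * q ^ n / (1 - q)) atTop (𝓝 0) := by
        have := ((tendsto_pow_atTop_nhds_zero_of_lt_one hq0 hq1).const_mul a).div_const (1 - q)
        simpa using this
      have hev : ∀ᶠ n : ℕ in atTop, a * q ^ n / (1 - q) < ε :=
        (tendsto_order.1 hgeom).2 ε hε
      refine hev.mono (fun n hn p hp => ?_)
      obtain ⟨hmem, -, -, -, hrate⟩ := (key p hp).choose_spec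
      rw [hxz p hp, dist_comm, dist_eq_norm]
      calc ‖xs p n - (key p hp).choose‖ ≤ ‖L p‖ * ‖f p (x₀ p)‖ * q ^ n / (1 - q) := hrate n
        _ ≤ a * q ^ n / (1 - q) := by
            apply div_le_div_of_nonneg_right _ h1q.le
            exact mul_le_mul_of_nonneg_right (ha p hp) (pow_nonneg hq0 n)
        _ < ε := hn
    exact hunif.continuousOn
      (Eventually.of_forall fun n => iterate_continuousOn hf hL hδ hq hq1 hr hx₀ hG n).frequently
  · obtain ⟨hmem, -, hzero, hdist, -⟩ := (key p hp).choose_spec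
    rw [hxz p hp]
    exact ⟨hmem, hzero, hdist⟩

end Summit.NavierStokesRegularity.NavierStokesRegularity.Theorems.NewtonKantorovich
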